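/-
Copyright (c) 2026. Released under Apache 2.0 license.
Literature formalization: the iteration bound of PSLQ (Ferguson–Bailey–Arno 1999, §3 Definition 5 and
Steps 1–3, §4 Lemmas 4–9, Definition 6, Theorem 2, Corollary 2), real case.
-/
import Mathlib
import Literature.NumberTheory.DiophantineApproximation.PSLQHxMatrix

/-!
# The iteration bound of PSLQ (Ferguson–Bailey–Arno 1999, §4: Lemmas 4–9, Definition 6, Theorem 2), real case

Topic `Literature/NumberTheory/DiophantineApproximation`. H. R. P. Ferguson, D. H. Bailey, S. Arno,
*Analysis of PSLQ, an integer relation finding algorithm*, Math. Comp. 68 (1999), no. 225, 351–369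
[FergusonBaileyArno1999]: Definition 5 (p. 356), the proof of Lemma 5 and the facts about Steps 1–3
quoted on p. 357, Lemmas 6–9 and Definition 6 (pp. 357–360), Theorem 2 (p. 360) and Corollary 2
(pp. 360–361), real case `K = ℝ`, `O(K) = ℤ`, `ρ = 2`. It continues `PSLQRelationBound.lean`
(Theorem 1, factored) and `PSLQHxMatrix.lean` (`H_x`, Lemmas 1–2, Theorem 1 verbatim): those give the
LOWER BOUND on relations that PSLQ certifies; this file gives the TERMINATION GUARANTEE — the number of
iterations is bounded by `(n choose 2) log(γ^{n−1} M_x)/log τ`.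

Throughout `n = d + 1` and the diagonal indices `1 ≤ j ≤ n − 1` of the paper are `j : Fin d`
(0-based: the paper's `j` is `j.val + 1`, so `γ^j` is `γ ^ (j.val + 1)` and the exponent `n − j` of
Definition 6 is `d − j.val`).

## What is formalised, and how

§4 of the paper argues entirely on the vector of SIZES OF THE DIAGONAL ENTRIES `|h_{j,j}(k)|` of the
lower trapezoidal matrices `H(k) = A H_x Q`: every lemma from Lemma 6 on uses only (a) the choice of
the pivot `r` in Step 1, (b) the bound `|β| ≤ |α|/ρ` delivered by Hermite reduction (Lemma 4), (c) the
explicit `2 × 2` corner computation of Step 2, (d) that Step 3 does not touch the diagonal, and (e) the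
conclusion of Theorem 1 for the current `H(k)`. We formalise exactly this layer:

* **Definition 5** — `pslqTau γ = (1/ρ² + 1/γ²)^{−1/2}` with `ρ = 2`: `one_div_pslqTau_sq`
  (`1/τ² = 1/ρ² + 1/γ²`), `one_lt_pslqTau` (`τ > 1` for `γ > 2/√3`), `pslqTau_le_two` (`τ ≤ ρ`),
  `pslqTau_le_self` (`τ ≤ γ`), and the key inequality of p. 357 `sqrt_sq_add_sq_le_div_pslqTau`
  ("`t = (ββ* + λλ*)^{1/2}/|α| ≤ (1/ρ² + 1/γ²)^{1/2}`", i.e. `δ ≤ |α|/τ`).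
* **Lemma 4** (one entry, `FergusonBaileyArno1999_lemma4_entry`: `|a − nint(a/p) p| ≤ |p|/2`), the
  facts (c), (d) as stand-alone matrix identities (`FergusonBaileyArno1999_corner_step`: the printed
  "`(β λ; α 0) ↦ (δ 0; αβ/δ −αλ/δ)`", `FergusonBaileyArno1999_corner_orthogonal`: the corner block of
  `Q` is orthogonal, `diag_unitLowerTriangular_mul`: a unit lower triangular `D` does not move the
  diagonal of a lower trapezoidal `H`), and the relation-extraction half of **Lemma 5**
  (`FergusonBaileyArno1999_lemma5_relation`: `x H_x = 0`, `B A = I`, a column of `A H_x Q` supported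
  in the single row `i` ⟹ `(x B)_i = 0`, so column `i` of `B ∈ GL(n, ℤ)` is an integer relation;
  `…_column_ne_zero`: it is non-zero).
* **One iteration on the diagonal** — the structure `PSLQDiagStep γ h h' r β` records, for the old
  sizes `h`, the new sizes `h'`, the pivot `r` and the sub-pivot entry `β`, precisely the facts
  (a)–(d) in the form p. 357 states them (fields `exchange`, `reduced`, `corner_fst`, `corner_snd`,
  `last`, `unchanged`; see its docstring for the quotations).
* **Lemma 6** (`PSLQDiagStep.le_one`: sizes `≤ 1` are preserved; base case `pslqH_diag_pos_le_one`:
  `0 < h_{j,j}(0) = s_{j+1}/s_j ≤ 1`), **Lemma 7** verbatim (`FergusonBaileyArno1999_lemma7`,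
  `…_quotient`), **Lemma 8** (`PSLQDiagStep.lemma8`: `γ^{n−2} M_x |α| ≥ 1` from Theorem 1's
  `∃ j₀, M_x ≥ 1/|h_{j₀,j₀}|`), **Definition 6** (`pslqPi G h = ∏ⱼ min{G, 1/hⱼ}^{n−j}`,
  `G = γ^{n−1} M_x`; `pslqPiExp`, `pslqPiExp_eq_choose`: the total exponent is `(n choose 2)`),
  **Lemma 9** (i) (`FergusonBaileyArno1999_lemma9_i`) and (ii) (`PSLQDiagStep.tau_mul_pslqPi_le`:
  `Π(k) ≥ τ Π(k−1)`, through the two printed cases `FergusonBaileyArno1999_lemma9_corner_factors`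
  (`r < n − 1`) and `FergusonBaileyArno1999_lemma9_last_factor` (`r = n − 1`)).
* **Theorem 2** (`FergusonBaileyArno1999_theorem2`): along any run `H(0), …, H(K)` of zero-free
  diagonals linked by such steps, starting from sizes `≤ 1` and with Theorem 1's conclusion available at
  every step, `τ^K ≤ (γ^{n−1} M_x)^{(n choose 2)}` and `K ≤ (n choose 2) log(γ^{n−1} M_x)/log τ`;
  **Corollary 2**, real case (`FergusonBaileyArno1999_corollary2_real`: with `γ = 2`, `τ = √2`
  (`pslqTau_two`), `K ≤ 2 (n³ + n² log M_x)`).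

One printed line is completed rather than followed: in the case `r < n − 1` of Lemma 9 (ii) the paper
writes "`min{A,1}/min{A,t} ≥ 1/t ≥ τ`", which is the case `A ≥ 1`; when `t ≤ A < 1` the quotient is
`A/t = γ^{n−1} M_x |α| ≥ γ ≥ τ` by Lemma 8 — exactly the argument the paper itself prints for the case
`r = n − 1` ("If `t ≤ A ≤ t/ρ`, then `Π(k)/Π(k−1) ≥ A/t ≥ γ ≥ τ`"). `tau_mul_min_le` records the
completed step. Lemma 9 (i) uses `M_x ≥ 1` (printed: "Moreover, `M_x ≥ 1`"), which we carry as the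
hypothesis `1 ≤ M` (the norm of a non-zero integer vector).

Deliberately NOT here: the recursion of Definitions 3–4 (Hermite reduction as a matrix algorithm) and
Lemma 3, the bookkeeping that assembles an actual PSLQ run `H(k) = A(k) H_x Q(k)` into a sequence of
`PSLQDiagStep`s (the structure's fields are the interface: a verified implementation, or a client,
discharges them from its own Steps 1–3), Theorem 3 (the `γ^{n−2}` bound on the norm of the relation
found), the complex and quaternion cases (`ρ = √2`, Lemma 10 ff.).

USE: this is the published guarantee behind "PSLQ terminates": with `γ > 2/√3` fixed, an exact (or
validated) PSLQ run on a unit vector `x ∈ ℝⁿ` possessing an integer relation of norm `≤ M_x` cannot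
perform more than `(n choose 2) log(γ^{n−1} M_x)/log τ` iterations with all diagonal entries non-zero —
so within that many iterations a diagonal entry vanishes and Lemma 5 hands over a relation (a column of
`B = A⁻¹`). An implementation's iteration cap is to be compared with this number.

## References

* [FergusonBaileyArno1999] H. R. P. Ferguson, D. H. Bailey, S. Arno, Analysis of PSLQ, an integer
  relation finding algorithm, Math. Comp. 68 (1999) 351–369: Definition 5 (p. 356), Lemma 4 and
  Lemma 5 with its proof (pp. 356–358), Lemmas 6–8, Definition 6, Lemma 9 with its proof
  (pp. 358–360), Theorem 2 and Corollary 2 (pp. 360–361). doi:10.1090/S0025-5718-99-00995-3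
-/

namespace Literature.NumberTheory.DiophantineApproximation

open Matrix Finset

/-! ## Definition 5: the parameters `γ`, `ρ = 2` and `τ` (real case) -/

/-- **Definition 5 (the parameter `τ`), real case**: "Fix the real number `γ > 2/√3` … define the real
number `τ` by `1/τ² = 1/ρ² + 1/γ²`, where `ρ` is defined as in Lemma 4" (`ρ = 2` for `K = ℝ`). Here
`pslqTau γ = (1/4 + 1/γ²)^{-1/2}`. [cite: FergusonBaileyArno1999, Definition 5] -/
noncomputable def pslqTau (γ : ℝ) : ℝ := 1 / Real.sqrt (1 / 4 + 1 / γ ^ 2)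

/-- `1/ρ² + 1/γ² > 0`. [cite: FergusonBaileyArno1999, Definition 5] -/
theorem pslqTau_radicand_pos (γ : ℝ) : 0 < 1 / 4 + 1 / γ ^ 2 := by positivity

/-- `τ > 0`. [cite: FergusonBaileyArno1999, Definition 5] -/
theorem pslqTau_pos (γ : ℝ) : 0 < pslqTau γ := by
  unfold pslqTau
  exact div_pos one_pos (Real.sqrt_pos.mpr (pslqTau_radicand_pos γ))

/-- `1/τ = (1/ρ² + 1/γ²)^{1/2}` (`ρ = 2`). [cite: FergusonBaileyArno1999, Definition 5] -/
theorem one_div_pslqTau (γ : ℝ) : 1 / pslqTau γ = Real.sqrt (1 / 4 + 1 / γ ^ 2) := by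
  unfold pslqTau
  rw [one_div_one_div]

/-- `1/τ² = 1/ρ² + 1/γ²` with `ρ = 2`, verbatim. [cite: FergusonBaileyArno1999, Definition 5] -/
theorem one_div_pslqTau_sq (γ : ℝ) : 1 / pslqTau γ ^ 2 = 1 / 2 ^ 2 + 1 / γ ^ 2 := by
  rw [← _root_.one_div_pow, one_div_pslqTau, Real.sq_sqrt (le_of_lt (pslqTau_radicand_pos γ))]
  norm_num

/-- Definition 5: "`1 < τ` … clearly these conditions are satisfied in the real and complex cases" —
for `γ > 2/√3`. [cite: FergusonBaileyArno1999, Definition 5] -/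
theorem one_lt_pslqTau {γ : ℝ} (hγ : 2 / Real.sqrt 3 < γ) : 1 < pslqTau γ := by
  have h3 : 0 < Real.sqrt 3 := Real.sqrt_pos.mpr (by norm_num)
  have hγ0 : 0 < γ := lt_trans (div_pos two_pos h3) hγ
  -- `γ² > 4/3`
  have hsq : 4 / 3 < γ ^ 2 := by
    have h1 : (2 / Real.sqrt 3) ^ 2 = 4 / 3 := by
      rw [div_pow, Real.sq_sqrt (by norm_num : (0:ℝ) ≤ 3)]; norm_num
    rw [← h1]
    exact pow_lt_pow_left₀ hγ (le_of_lt (div_pos two_pos h3)) two_ne_zero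
  have hrad : 1 / 4 + 1 / γ ^ 2 < 1 := by
    have : 1 / γ ^ 2 < 3 / 4 := by
      rw [div_lt_div_iff₀ (by positivity) (by norm_num)]
      linarith
    linarith
  unfold pslqTau
  rw [lt_div_iff₀ (Real.sqrt_pos.mpr (pslqTau_radicand_pos γ)), one_mul]
  rw [Real.sqrt_lt' one_pos]
  simpa using hrad

/-- Definition 5: "`τ ≤ ρ`" (`ρ = 2`). [cite: FergusonBaileyArno1999, Definition 5] -/
theorem pslqTau_le_two (γ : ℝ) : pslqTau γ ≤ 2 := by
  unfold pslqTau
  have h : (1 : ℝ) / 2 ≤ Real.sqrt (1 / 4 + 1 / γ ^ 2) := by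
    rw [Real.le_sqrt (by norm_num) (le_of_lt (pslqTau_radicand_pos γ))]
    have : (0 : ℝ) ≤ 1 / γ ^ 2 := by positivity
    linarith
  calc 1 / Real.sqrt (1 / 4 + 1 / γ ^ 2) ≤ 1 / (1 / 2) :=
        one_div_le_one_div_of_le (by norm_num) h
    _ = 2 := by norm_num

/-- `τ ≤ γ` (since `1/τ² ≥ 1/γ²`), used in the proof of Lemma 9 (ii) ("`A/t ≥ γ ≥ τ`").
[cite: FergusonBaileyArno1999, Definition 5; Lemma 9 (proof)] -/
theorem pslqTau_le_self {γ : ℝ} (hγ : 0 < γ) : pslqTau γ ≤ γ := by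
  unfold pslqTau
  have h : 1 / γ ≤ Real.sqrt (1 / 4 + 1 / γ ^ 2) := by
    rw [Real.le_sqrt (by positivity) (le_of_lt (pslqTau_radicand_pos γ))]
    rw [_root_.one_div_pow]
    linarith
  calc 1 / Real.sqrt (1 / 4 + 1 / γ ^ 2) ≤ 1 / (1 / γ) :=
        one_div_le_one_div_of_le (by positivity) h
    _ = γ := one_div_one_div γ

/-- The inequality `t ≤ 1/τ` of §4 ("`t = (ββ* + λλ*)^{1/2}/|α| ≤ (1/ρ² + 1/γ²)^{1/2}`", p. 357): if
`|β| ≤ α/2` (Hermite reduction, Lemma 4) and `0 ≤ λ` with `γ λ ≤ α` (Step 1), then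
`(β² + λ²)^{1/2} ≤ α/τ`. [cite: FergusonBaileyArno1999, §4 (p. 357)] -/
theorem sqrt_sq_add_sq_le_div_pslqTau {γ α β lam : ℝ} (hγ : 0 < γ) (hα : 0 ≤ α)
    (hβ : |β| ≤ α / 2) (hlam0 : 0 ≤ lam) (hlam : γ * lam ≤ α) :
    Real.sqrt (β ^ 2 + lam ^ 2) ≤ α / pslqTau γ := by
  have hl : lam ≤ α / γ := by rw [le_div_iff₀ hγ]; linarith
  have hb2 : β ^ 2 ≤ (α / 2) ^ 2 := by
    calc β ^ 2 = |β| ^ 2 := (sq_abs β).symm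
      _ ≤ (α / 2) ^ 2 := pow_le_pow_left₀ (abs_nonneg β) hβ 2
  have hl2 : lam ^ 2 ≤ (α / γ) ^ 2 := pow_le_pow_left₀ hlam0 hl 2
  have hsum : β ^ 2 + lam ^ 2 ≤ α ^ 2 * (1 / 4 + 1 / γ ^ 2) := by
    have e : (α / 2) ^ 2 + (α / γ) ^ 2 = α ^ 2 * (1 / 4 + 1 / γ ^ 2) := by
      field_simp; ring
    linarith
  have hrhs : α / pslqTau γ = Real.sqrt (α ^ 2 * (1 / 4 + 1 / γ ^ 2)) := by
    rw [Real.sqrt_mul' _ (le_of_lt (pslqTau_radicand_pos γ)), Real.sqrt_sq hα, div_eq_mul_one_div,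
      one_div_pslqTau]
  rw [hrhs]
  exact Real.sqrt_le_sqrt hsum

/-! ## Lemma 4 (one entry) and the corner step of Lemma 5 — what Steps 1–3 do to the diagonal -/

/-- **Lemma 4, real case, one entry** ("`|h'_{k,i}| ≤ |h_{i,i}|/ρ`", `ρ = 2`): reducing an entry `a`
against a non-zero pivot `p` by the nearest-integer multiple, `a' = a − nint(a/p)·p`, gives
`|a'| ≤ |p|/2` — "this follows from the definition of the nint function … and the fact that
`|z − nint(z)| ≤ 1/2`". (Definitions 3–4 apply this to every sub-diagonal entry `h_{k,i}`, `k > i`,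
with pivot `h_{i,i}`; the diagonal entries themselves are unchanged, `diag_unitLowerTriangular_mul`.)
[cite: FergusonBaileyArno1999, Lemma 4] -/
theorem FergusonBaileyArno1999_lemma4_entry (a p : ℝ) (hp : p ≠ 0) :
    |a - (round (a / p) : ℝ) * p| ≤ |p| / 2 := by
  have h : a - (round (a / p) : ℝ) * p = (a / p - round (a / p)) * p := by
    field_simp
  rw [h, abs_mul]
  have h2 : |a / p - round (a / p)| ≤ 1 / 2 := abs_sub_round (a / p)
  calc |a / p - ↑(round (a / p))| * |p| ≤ (1 / 2) * |p| :=
        mul_le_mul_of_nonneg_right h2 (abs_nonneg p)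
    _ = |p| / 2 := by ring

/-- **Step 3 does not move the diagonal** ("Hermite reduction doesn't introduce any new zeros on the
diagonal", proof of Lemma 5): if `D` is unit lower triangular (`D_{i,i} = 1`, `D_{i,k} = 0` for `i < k`;
the reducing matrix of Definition 3) and the column `j` of `H` vanishes above its diagonal row `f j`
(`H` lower trapezoidal), then `(D H)_{f j, j} = H_{f j, j}`. [cite: FergusonBaileyArno1999, Lemma 5 (proof)] -/
theorem diag_unitLowerTriangular_mul {n m : ℕ} (D : Matrix (Fin n) (Fin n) ℝ)
    (H : Matrix (Fin n) (Fin m) ℝ) (hD1 : ∀ i, D i i = 1) (hD0 : ∀ i k, i < k → D i k = 0)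
    (f : Fin m → Fin n) (hH : ∀ i j, i < f j → H i j = 0) (j : Fin m) :
    (D * H) (f j) j = H (f j) j := by
  rw [Matrix.mul_apply]
  rw [Finset.sum_eq_single (f j)]
  · rw [hD1, one_mul]
  · intro k _ hk
    rcases lt_or_gt_of_ne hk with hlt | hgt
    · rw [hH k j hlt, mul_zero]
    · rw [hD0 (f j) k hgt, zero_mul]
  · intro h; exact absurd (Finset.mem_univ _) h

/-- **Steps 1–2 on the `2 × 2` corner (proof of Lemma 5).** With `α = h_{r,r}`, `β = h_{r+1,r}`,
`λ = h_{r+1,r+1}` and `δ = (β² + λ²)^{1/2} > 0`: after the exchange the corner `(α 0; β λ)` becomes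
`(β λ; α 0)`, and post-multiplying by the corner block `(β/δ −λ/δ; λ/δ β/δ)` of the matrix `Q` of
Step 2 gives "the matrix `(δ 0; αβ/δ −αλ/δ)`" — lower triangular again, with new diagonal entries
`δ` and `−αλ/δ`. [cite: FergusonBaileyArno1999, Lemma 5 (proof), Step 2] -/
theorem FergusonBaileyArno1999_corner_step (α β lam δ : ℝ) (hδ : 0 < δ) (hδ2 : δ ^ 2 = β ^ 2 + lam ^ 2) :
    !![β, lam; α, 0] * !![β / δ, -lam / δ; lam / δ, β / δ] = !![δ, 0; α * β / δ, -(α * lam) / δ] := by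
  have hδ0 : δ ≠ 0 := hδ.ne'
  have e1 : β * (β / δ) + lam * (lam / δ) = δ := by
    field_simp; nlinarith [hδ2]
  have e2 : β * (-lam / δ) + lam * (β / δ) = 0 := by ring
  have e3 : α * (β / δ) + 0 * (lam / δ) = α * β / δ := by ring
  have e4 : α * (-lam / δ) + 0 * (β / δ) = -(α * lam) / δ := by ring
  rw [Matrix.mul_fin_two, e1, e2, e3, e4]

/-- The corner block of the Step 2 matrix `Q` is orthogonal (real unitary): `Q Qᵀ = I₂` and
`Qᵀ Q = I₂`. [cite: FergusonBaileyArno1999, Step 2] -/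
theorem FergusonBaileyArno1999_corner_orthogonal (β lam δ : ℝ) (hδ : 0 < δ)
    (hδ2 : δ ^ 2 = β ^ 2 + lam ^ 2) :
    !![β / δ, -lam / δ; lam / δ, β / δ] * !![β / δ, -lam / δ; lam / δ, β / δ]ᵀ = 1 ∧
    !![β / δ, -lam / δ; lam / δ, β / δ]ᵀ * !![β / δ, -lam / δ; lam / δ, β / δ] = 1 := by
  have hδ0 : δ ≠ 0 := hδ.ne'
  have hT : (!![β / δ, -lam / δ; lam / δ, β / δ] : Matrix (Fin 2) (Fin 2) ℝ)ᵀ =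
      !![β / δ, lam / δ; -lam / δ, β / δ] := by
    ext i j; fin_cases i <;> fin_cases j <;> rfl
  have o1 : β / δ * (β / δ) + -lam / δ * (-lam / δ) = 1 := by field_simp; nlinarith [hδ2]
  have o2 : β / δ * (lam / δ) + -lam / δ * (β / δ) = 0 := by ring
  have o3 : lam / δ * (β / δ) + β / δ * (-lam / δ) = 0 := by ring
  have o4 : lam / δ * (lam / δ) + β / δ * (β / δ) = 1 := by field_simp; nlinarith [hδ2]
  have o5 : β / δ * (β / δ) + lam / δ * (lam / δ) = 1 := by field_simp; nlinarith [hδ2]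
  have o6 : β / δ * (-lam / δ) + lam / δ * (β / δ) = 0 := by ring
  have o7 : -lam / δ * (β / δ) + β / δ * (lam / δ) = 0 := by ring
  have o8 : -lam / δ * (-lam / δ) + β / δ * (β / δ) = 1 := by field_simp; nlinarith [hδ2]
  rw [hT, Matrix.mul_fin_two, Matrix.mul_fin_two, o1, o2, o3, o4, o5, o6, o7, o8,
    Matrix.one_fin_two]
  exact ⟨rfl, rfl⟩

/-- The sizes of the two new diagonal entries of the corner step: `|δ| = |α| t` and `|−αλ/δ| = |λ|/t`
with `t = δ/|α|` (proof of Lemma 6); in particular `|−αλ/δ| ≤ |α|` because `|λ| ≤ δ`.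
[cite: FergusonBaileyArno1999, Lemma 6 (proof)] -/
theorem FergusonBaileyArno1999_corner_snd_le (α lam δ : ℝ) (hα : 0 ≤ α) (hδ : 0 < δ)
    (hlamδ : lam ≤ δ) : α * lam / δ ≤ α := by
  rw [div_le_iff₀ hδ]
  exact mul_le_mul_of_nonneg_left hlamδ hα

/-- **Lemma 6, base case `H(0) = H_x`**: the diagonal entries `h_{j,j} = s_{j+1}/s_j` of `H_x`
satisfy `0 < h_{j,j} ≤ 1` (as `s_j² = x_j² + s_{j+1}²`). [cite: FergusonBaileyArno1999, Lemma 6] -/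
theorem pslqH_diag_pos_le_one {d : ℕ} (x : Fin (d + 1) → ℝ) (h0 : ∀ i, x i ≠ 0) (j : Fin d) :
    0 < pslqH x j.castSucc j ∧ pslqH x j.castSucc j ≤ 1 := by
  rw [pslqH_apply_diag]
  have hs := pslqPartialNorm_pos x h0 j.succ
  have hc := pslqPartialNorm_pos x h0 j.castSucc
  refine ⟨div_pos hs hc, ?_⟩
  rw [div_le_one hc]
  have h2 : pslqPartialNorm x j.succ ^ 2 ≤ pslqPartialNorm x j.castSucc ^ 2 := by
    rw [pslqPartialNorm_sq, pslqPartialNorm_sq, pslqPartialSq_castSucc]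
    nlinarith [sq_nonneg (x j.castSucc)]
  exact (pow_le_pow_iff_left₀ hs.le hc.le two_ne_zero).mp h2

/-! ## The diagonal data of one iteration of PSLQ(γ) (Steps 1–3, §3; §4 p. 357) -/

variable {d : ℕ}

/-- **One iteration of PSLQ(γ) seen on the diagonal** (real case; `n = d + 1`, diagonal indices
`j : Fin d` ↔ the paper's `1 ≤ j ≤ n − 1`). `h j = |h_{j,j}(k−1)|` are the sizes of the diagonal
entries before the iteration (all non-zero), `h' j = |h_{j,j}(k)|` after it, `r` is the pivot of
Step 1 and `β = h_{r+1,r}(k−1)` the sub-diagonal entry below the pivot. The fields are exactly the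
facts about Steps 1–3 that §4 uses (p. 357 and the proofs of Lemmas 5, 6, 9):
* `exchange` — Step 1: "Choose an integer `r` such that `γ^r |h_{r,r}| ≥ γ^i |h_{i,i}|` for all
  `1 ≤ i ≤ n − 1`";
* `reduced` — "Because `H` is Hermite reduced in Step 3, from Lemma 4, `|β| ≤ |α|/ρ`" (`ρ = 2`;
  `FergusonBaileyArno1999_lemma4_entry`);
* `corner_fst`, `corner_snd`, `unchanged` — for `r < n − 1` "only two diagonal elements change":
  the corner `(α 0; β λ)` becomes `(δ 0; αβ/δ −αλ/δ)`, `δ = (ββ* + λλ*)^{1/2}`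
  (`FergusonBaileyArno1999_corner_step`; Step 3 leaves the diagonal alone,
  `diag_unitLowerTriangular_mul`);
* `last` — for `r = n − 1` the exchange makes `β = h_{n,n−1}(k−1)` the new last diagonal entry
  ("in order to have `h_{n−1,n−1}(k) = 0`, we must have `h_{n,n−1}(k − 1) = 0`", proof of Lemma 5).
[cite: FergusonBaileyArno1999, §3 Steps 1–3; §4 p. 357] -/
structure PSLQDiagStep (γ : ℝ) (h h' : Fin d → ℝ) (r : Fin d) (β : ℝ) : Prop where
  pos : ∀ j, 0 < h j
  exchange : ∀ i : Fin d, γ ^ ((i : ℕ) + 1) * h i ≤ γ ^ ((r : ℕ) + 1) * h r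
  reduced : |β| ≤ h r / 2
  corner_fst : ∀ hr : (r : ℕ) + 1 < d, h' r = Real.sqrt (β ^ 2 + h ⟨(r : ℕ) + 1, hr⟩ ^ 2)
  corner_snd : ∀ hr : (r : ℕ) + 1 < d,
    h' ⟨(r : ℕ) + 1, hr⟩ = h r * h ⟨(r : ℕ) + 1, hr⟩ / Real.sqrt (β ^ 2 + h ⟨(r : ℕ) + 1, hr⟩ ^ 2)
  last : (r : ℕ) + 1 = d → h' r = |β|
  unchanged : ∀ i : Fin d, i ≠ r → (i : ℕ) ≠ (r : ℕ) + 1 → h' i = h i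

namespace PSLQDiagStep

variable {γ : ℝ} {h h' : Fin d → ℝ} {r : Fin d} {β : ℝ}

/-- "From the Step 1 Exchange, `0 ≤ |λ| ≤ |α|/γ`" (p. 357): `γ λ ≤ α` for `λ = h_{r+1,r+1}`,
`α = h_{r,r}`. [cite: FergusonBaileyArno1999, §4 (p. 357)] -/
theorem gamma_mul_next_le (S : PSLQDiagStep γ h h' r β) (hγ : 0 < γ) (hr : (r : ℕ) + 1 < d) :
    γ * h ⟨(r : ℕ) + 1, hr⟩ ≤ h r := by
  have e := S.exchange ⟨(r : ℕ) + 1, hr⟩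
  have hp : 0 < γ ^ ((r : ℕ) + 1) := pow_pos hγ _
  have e' : γ ^ ((r : ℕ) + 1) * (γ * h ⟨(r : ℕ) + 1, hr⟩) ≤ γ ^ ((r : ℕ) + 1) * h r := by
    calc γ ^ ((r : ℕ) + 1) * (γ * h ⟨(r : ℕ) + 1, hr⟩)
        = γ ^ ((r : ℕ) + 1 + 1) * h ⟨(r : ℕ) + 1, hr⟩ := by rw [pow_succ]; ring
      _ ≤ γ ^ ((r : ℕ) + 1) * h r := e
  exact le_of_mul_le_mul_left e' hp

/-- The corner quantity `δ = (β² + λ²)^{1/2}` is positive and satisfies `λ ≤ δ ≤ α/τ`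
("`t ≤ τ`" and "`|λ| ≤ |α| t`", p. 357). [cite: FergusonBaileyArno1999, §4 (p. 357)] -/
theorem delta_bounds (S : PSLQDiagStep γ h h' r β) (hγ : 0 < γ) (hr : (r : ℕ) + 1 < d) :
    0 < Real.sqrt (β ^ 2 + h ⟨(r : ℕ) + 1, hr⟩ ^ 2) ∧
    h ⟨(r : ℕ) + 1, hr⟩ ≤ Real.sqrt (β ^ 2 + h ⟨(r : ℕ) + 1, hr⟩ ^ 2) ∧
    Real.sqrt (β ^ 2 + h ⟨(r : ℕ) + 1, hr⟩ ^ 2) ≤ h r / pslqTau γ := by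
  have hl : 0 < h ⟨(r : ℕ) + 1, hr⟩ := S.pos _
  refine ⟨?_, ?_, ?_⟩
  · apply Real.sqrt_pos.mpr; positivity
  · calc h ⟨(r : ℕ) + 1, hr⟩ = Real.sqrt (h ⟨(r : ℕ) + 1, hr⟩ ^ 2) := (Real.sqrt_sq hl.le).symm
      _ ≤ Real.sqrt (β ^ 2 + h ⟨(r : ℕ) + 1, hr⟩ ^ 2) := Real.sqrt_le_sqrt (by nlinarith [sq_nonneg β])
  · exact sqrt_sq_add_sq_le_div_pslqTau hγ (S.pos r).le S.reduced hl.le (S.gamma_mul_next_le hγ hr)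

/-- **Lemma 6 (one iteration).** "At any `k`-th iteration of the algorithm the diagonal entries of
`H(k)` satisfy the inequality `|h_{i,i}(k)| ≤ 1`": if all `|h_{j,j}(k−1)| ≤ 1` then all
`|h_{j,j}(k)| ≤ 1` ("When `r = n − 1` … the `r`-th diagonal element is `β`. But `|β| ≤ |α|/ρ ≤ 1` …
When `r < n − 1` … `|δ| = |α| t ≤ 1` … `|−αλ/δ| = |λ|/t ≤ |α|`"). The base case `H(0) = H_x`,
`|h_{j,j}| = s_{j+1}/s_j ≤ 1`, is `pslqH_diag_le_one`. [cite: FergusonBaileyArno1999, Lemma 6] -/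
theorem le_one (S : PSLQDiagStep γ h h' r β) (hγ : 2 / Real.sqrt 3 < γ) (h1 : ∀ j, h j ≤ 1) :
    ∀ j, h' j ≤ 1 := by
  have h3 : 0 < Real.sqrt 3 := Real.sqrt_pos.mpr (by norm_num)
  have hγ0 : 0 < γ := lt_trans (div_pos two_pos h3) hγ
  have hτ1 : 1 < pslqTau γ := one_lt_pslqTau hγ
  have hα1 : h r ≤ 1 := h1 r
  have hα0 : 0 < h r := S.pos r
  intro j
  by_cases hj : j = r
  · subst hj
    rcases Nat.lt_or_ge ((j : ℕ) + 1) d with hr | hr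
    · obtain ⟨hδ0, hlδ, hδ⟩ := S.delta_bounds hγ0 hr
      rw [S.corner_fst hr]
      calc Real.sqrt (β ^ 2 + h ⟨(j : ℕ) + 1, hr⟩ ^ 2) ≤ h j / pslqTau γ := hδ
        _ ≤ h j / 1 := div_le_div_of_nonneg_left hα0.le one_pos hτ1.le
        _ ≤ 1 := by rw [div_one]; exact hα1
    · have hr' : (j : ℕ) + 1 = d := le_antisymm j.isLt hr
      rw [S.last hr']
      calc |β| ≤ h j / 2 := S.reduced
        _ ≤ 1 := by linarith
  · by_cases hj2 : (j : ℕ) = (r : ℕ) + 1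
    · have hr : (r : ℕ) + 1 < d := hj2 ▸ j.isLt
      have hjj : j = ⟨(r : ℕ) + 1, hr⟩ := Fin.ext hj2
      subst hjj
      obtain ⟨hδ0, hlδ, hδ⟩ := S.delta_bounds hγ0 hr
      rw [S.corner_snd hr]
      calc h r * h ⟨(r : ℕ) + 1, hr⟩ / Real.sqrt (β ^ 2 + h ⟨(r : ℕ) + 1, hr⟩ ^ 2) ≤ h r :=
            FergusonBaileyArno1999_corner_snd_le _ _ _ hα0.le hδ0 hlδ
        _ ≤ 1 := hα1
    · rw [S.unchanged j hj hj2]; exact h1 j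

/-- **Lemma 8.** "For `α, γ, M_x` as above, `γ^{n−2} M_x |α| ≥ 1`" — here `n − 2 = d − 1`, `α = h_{r,r}`
the pivot of Step 1, and the hypothesis is the conclusion of Theorem 1 for the current `H`
(`∃ j₀, 1 ≤ |h_{j₀,j₀}| · M_x`, `FergusonBaileyArno1999_theorem1_pslqH`): "`γ^{n−1}/|h_{j,j}| ≥
γ^r/|h_{j,j}| ≥ γ^j/|α| ≥ γ/|α|` for all `j` including that `j₀` for which `M_x ≥ 1/|h_{j₀,j₀}|`".
[cite: FergusonBaileyArno1999, Lemma 8] -/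
theorem lemma8 (S : PSLQDiagStep γ h h' r β) (hγ : 1 ≤ γ) {M : ℝ} (hT1 : ∃ j₀, 1 ≤ h j₀ * M) :
    1 ≤ γ ^ (d - 1) * M * h r := by
  obtain ⟨j₀, hj₀⟩ := hT1
  have hγ0 : 0 < γ := lt_of_lt_of_le one_pos hγ
  have hh0 : 0 < h j₀ := S.pos j₀
  have hM : 0 ≤ M := by nlinarith
  have hd : d - 1 + 1 = d := Nat.sub_add_cancel (Fin.pos r)
  -- `γ · h_{j₀} ≤ γ^{j₀+1} h_{j₀} ≤ γ^{r+1} α ≤ γ^d α = γ · γ^{d-1} α`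
  have h1 : γ * h j₀ ≤ γ ^ ((j₀ : ℕ) + 1) * h j₀ := by
    apply mul_le_mul_of_nonneg_right _ hh0.le
    calc γ = γ ^ 1 := (pow_one γ).symm
      _ ≤ γ ^ ((j₀ : ℕ) + 1) := pow_le_pow_right₀ hγ (by omega)
  have h2 : γ ^ ((r : ℕ) + 1) * h r ≤ γ ^ d * h r := by
    apply mul_le_mul_of_nonneg_right _ (S.pos r).le
    exact pow_le_pow_right₀ hγ (by have := r.isLt; omega)
  have h3 : γ * h j₀ ≤ γ * (γ ^ (d - 1) * h r) := by
    calc γ * h j₀ ≤ γ ^ ((r : ℕ) + 1) * h r := h1.trans (S.exchange j₀)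
      _ ≤ γ ^ d * h r := h2
      _ = γ * (γ ^ (d - 1) * h r) := by
          conv_lhs => rw [← hd, pow_succ]
          ring
  have h4 : h j₀ ≤ γ ^ (d - 1) * h r := le_of_mul_le_mul_left h3 hγ0
  calc 1 ≤ h j₀ * M := hj₀
    _ ≤ γ ^ (d - 1) * h r * M := mul_le_mul_of_nonneg_right h4 hM
    _ = γ ^ (d - 1) * M * h r := by ring

end PSLQDiagStep

/-! ## Lemma 7 and the two factor inequalities of the proof of Lemma 9 (ii) -/

/-- **Lemma 7**, verbatim. "Consider the quotient
`q(A, B, t) = (min{B, t} · min{A, 1}) / (min{B, 1} · min{A, t})`. Suppose that the four positive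
real numbers `A, B, 1, t` satisfy the three inequalities `A ≥ B`, `A ≥ t`, `1 ≥ t`. Then
`q(A, B, t) ≥ 1`." Stated multiplied out (`A > 0` follows from `A ≥ t > 0` and is not a separate
hypothesis). [cite: FergusonBaileyArno1999, Lemma 7] -/
theorem FergusonBaileyArno1999_lemma7 {A B t : ℝ} (hB : 0 < B) (ht : 0 < t)
    (hAB : B ≤ A) (hAt : t ≤ A) (ht1 : t ≤ 1) :
    min B 1 * min A t ≤ min B t * min A 1 := by
  rw [min_eq_right hAt]
  rcases le_or_gt 1 A with hA1 | hA1
  · rw [min_eq_right hA1]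
    rcases le_or_gt B t with hBt | hBt
    · rw [min_eq_left hBt, min_eq_left (hBt.trans ht1)]; nlinarith
    · rw [min_eq_right hBt.le]
      nlinarith [min_le_right B 1, lt_min hB one_pos]
  · rw [min_eq_left hA1.le, min_eq_left (hAB.trans hA1.le)]
    rcases le_or_gt B t with hBt | hBt
    · rw [min_eq_left hBt]; nlinarith
    · rw [min_eq_right hBt.le]; nlinarith

/-- Lemma 7 as printed: `q(A, B, t) ≥ 1`. [cite: FergusonBaileyArno1999, Lemma 7] -/
theorem FergusonBaileyArno1999_lemma7_quotient {A B t : ℝ} (hA : 0 < A) (hB : 0 < B) (ht : 0 < t)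
    (hAB : B ≤ A) (hAt : t ≤ A) (ht1 : t ≤ 1) :
    1 ≤ (min B t * min A 1) / (min B 1 * min A t) := by
  have hpos : 0 < min B 1 * min A t := mul_pos (lt_min hB one_pos) (lt_min hA ht)
  rw [le_div_iff₀ hpos, one_mul]
  exact FergusonBaileyArno1999_lemma7 hB ht hAB hAt ht1

/-- The first factor of the proof of Lemma 9 (ii), case `r < n − 1`:
`min{A, 1}/min{A, t} ≥ τ` (as printed "`≥ 1/t ≥ τ`" when `A ≥ 1`; when `t ≤ A < 1` the quotient is
`A/t = γ^{n−1} M_x |α| ≥ γ ≥ τ` by Lemma 8 — the case the printed line leaves implicit).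
[cite: FergusonBaileyArno1999, Lemma 9 (proof)] -/
theorem tau_mul_min_le {A t τ : ℝ} (hτt : τ * t ≤ 1) (hτA : τ * t ≤ A) (htA : t ≤ A) :
    τ * min A t ≤ min A 1 := by
  rw [min_eq_right htA]
  exact le_min hτA hτt

/-- The two changed factors of `Π` in the case `r < n − 1` of Lemma 9 (ii), with the exponents
`n − r = e` and `n − r − 1 = e − 1`: writing `A = γ^{n−1} M_x |α| t` (`= G δ`), `B = γ^{n−1} M_x |λ|`
(`= G λ`), "`Π(k)/Π(k−1) = (min{A,1}/min{A,t})^{n−r} · (min{B,t}/min{B,1})^{n−r−1}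
= (min{A,1}/min{A,t}) · q(A,B,t)^{n−r−1} ≥ τ`". Here `G = γ^{n−1} M_x`, `α, λ` the two old
diagonal sizes, `δ = α t` and `α λ/δ` the two new ones. [cite: FergusonBaileyArno1999, Lemma 9 (proof)] -/
theorem FergusonBaileyArno1999_lemma9_corner_factors {G α lam δ τ γ : ℝ} {e : ℕ} (hα : 0 < α)
    (hlam : 0 < lam) (hlamδ : lam ≤ δ) (hδ : δ ≤ α / τ) (hτ : 1 < τ) (hτγ : τ ≤ γ) (hG : γ ≤ G * α)
    (he : 1 ≤ e) :
    τ * ((min G (1 / α)) ^ e * (min G (1 / lam)) ^ (e - 1)) ≤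
      (min G (1 / δ)) ^ e * (min G (δ / (α * lam))) ^ (e - 1) := by
  have hτ0 : 0 < τ := lt_trans one_pos hτ
  have hδ0 : 0 < δ := lt_of_lt_of_le hlam hlamδ
  have hGα : τ ≤ G * α := hτγ.trans hG
  have hG0 : 0 < G := by
    have : 0 < G * α := lt_of_lt_of_le hτ0 hGα
    exact pos_of_mul_pos_left this hα.le
  -- the paper's `t`, `A`, `B`
  set t := δ / α with ht_def
  set A := G * δ with hA_def
  set B := G * lam with hB_def
  have ht0 : 0 < t := div_pos hδ0 hα
  have hτt : τ * t ≤ 1 := by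
    rw [ht_def, mul_div_assoc', div_le_one hα]
    calc τ * δ ≤ τ * (α / τ) := mul_le_mul_of_nonneg_left hδ hτ0.le
      _ = α := by field_simp
  have ht1 : t ≤ 1 := by nlinarith
  have hA0 : 0 < A := mul_pos hG0 hδ0
  have hB0 : 0 < B := mul_pos hG0 hlam
  have hAB : B ≤ A := mul_le_mul_of_nonneg_left hlamδ hG0.le
  have hτA : τ * t ≤ A := by
    rw [ht_def, hA_def, mul_div_assoc']
    rw [div_le_iff₀ hα]
    calc τ * δ ≤ (G * α) * δ := mul_le_mul_of_nonneg_right hGα hδ0.le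
      _ = G * δ * α := by ring
  have htA : t ≤ A := by nlinarith
  -- the four factors in terms of `A`, `B`, `t`
  have e1 : min G (1 / α) = min A t / δ := by
    rw [← min_div_div_right hδ0.le]; congr 1
    · rw [hA_def]; field_simp
    · rw [ht_def]; field_simp
  have e2 : min G (1 / lam) = min B 1 / lam := by
    rw [← min_div_div_right hlam.le]; congr 1
    rw [hB_def]; field_simp
  have e3 : min G (1 / δ) = min A 1 / δ := by
    rw [← min_div_div_right hδ0.le]; congr 1
    rw [hA_def]; field_simp
  have e4 : min G (δ / (α * lam)) = min B t / lam := by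
    rw [← min_div_div_right hlam.le]; congr 1
    · rw [hB_def]; field_simp
    · rw [ht_def]; field_simp
  rw [e1, e2, e3, e4, div_pow, div_pow, div_pow, div_pow]
  -- reduce to the numerators
  have hden : 0 < δ ^ e * lam ^ (e - 1) := by positivity
  have key : τ * ((min A t) ^ e * (min B 1) ^ (e - 1)) ≤ (min A 1) ^ e * (min B t) ^ (e - 1) := by
    obtain ⟨m, rfl⟩ : ∃ m, e = m + 1 := ⟨e - 1, by omega⟩
    simp only [Nat.add_sub_cancel]
    have l7 := FergusonBaileyArno1999_lemma7 hB0 ht0 hAB htA ht1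
    have f1 := tau_mul_min_le hτt hτA htA
    have hX0 : 0 ≤ min A t := le_min hA0.le ht0.le
    have hY0 : 0 ≤ min B 1 := le_min hB0.le zero_le_one
    calc τ * ((min A t) ^ (m + 1) * (min B 1) ^ m)
        = (τ * min A t) * (min B 1 * min A t) ^ m := by rw [pow_succ, mul_pow]; ring
      _ ≤ min A 1 * (min B t * min A 1) ^ m := by
          apply mul_le_mul f1 (pow_le_pow_left₀ (mul_nonneg hY0 hX0) l7 m)
            (pow_nonneg (mul_nonneg hY0 hX0) m) (le_min hA0.le zero_le_one)
      _ = (min A 1) ^ (m + 1) * (min B t) ^ m := by rw [pow_succ, mul_pow]; ring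
  have hδe : 0 < δ ^ e := pow_pos hδ0 e
  have hle : 0 < lam ^ (e - 1) := pow_pos hlam _
  calc τ * ((min A t) ^ e / δ ^ e * ((min B 1) ^ (e - 1) / lam ^ (e - 1)))
      = τ * ((min A t) ^ e * (min B 1) ^ (e - 1)) / (δ ^ e * lam ^ (e - 1)) := by
        field_simp
    _ ≤ ((min A 1) ^ e * (min B t) ^ (e - 1)) / (δ ^ e * lam ^ (e - 1)) :=
        div_le_div_of_nonneg_right key hden.le
    _ = (min A 1) ^ e / δ ^ e * ((min B t) ^ (e - 1) / lam ^ (e - 1)) := by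
        field_simp

/-- The one changed factor of `Π` in the case `r = n − 1` of Lemma 9 (ii) (exponent `n − r = 1`): the
new last diagonal entry is `β` with `|β| ≤ |α|/ρ`, so "`Π(k)/Π(k−1) = min{γ^{n−1}M_x, 1/|β|} /
min{γ^{n−1}M_x, 1/|α|} ≥ … ≥ τ`" (using `γ^{n−2} M_x |α| ≥ 1`, `ρ ≥ τ`, `γ ≥ τ`).
[cite: FergusonBaileyArno1999, Lemma 9 (proof)] -/
theorem FergusonBaileyArno1999_lemma9_last_factor {G α b τ γ : ℝ} (hα : 0 < α) (hb : 0 < b)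
    (hbα : b ≤ α / 2) (hγ : 1 < γ) (hτ2 : τ ≤ 2) (hτγ : τ ≤ γ) (hG : γ ≤ G * α) :
    τ * min G (1 / α) ≤ min G (1 / b) := by
  have h1 : 1 / α ≤ G := by
    rw [div_le_iff₀ hα]; linarith
  rw [min_eq_right h1]
  apply le_min
  · calc τ * (1 / α) = τ / α := by ring
      _ ≤ G := by rw [div_le_iff₀ hα]; linarith
  · rw [mul_one_div, div_le_div_iff₀ hα hb]; nlinarith

/-! ## Definition 6 (the `Π` function), Lemma 9, Theorem 2 -/

/-- **Definition 6 (The `Π` function).** "`Π(k) = ∏_{1 ≤ j ≤ n−1} min{γ^{n−1} M_x, 1/|h_{j,j}(k)|}^{n−j}`."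
With `d = n − 1`, `G = γ^{n−1} M_x` and 0-based `j : Fin d` the exponent `n − j` reads `d − j`
(values `d, d − 1, …, 1`). [cite: FergusonBaileyArno1999, Definition 6] -/
noncomputable def pslqPi (G : ℝ) (h : Fin d → ℝ) : ℝ := ∏ j : Fin d, (min G (1 / h j)) ^ (d - (j : ℕ))

/-- The total exponent `∑_{1 ≤ j ≤ n−1} (n − j) = (n−1) + ⋯ + 2 + 1` of `Π`. [folklore] -/
def pslqPiExp (d : ℕ) : ℕ := ∑ j : Fin d, (d - (j : ℕ))

/-- "`(n choose 2) = n − 1 + ⋯ + 2 + 1`" (proof of Lemma 9 (i)): `2 · ∑_{j<d} (d − j) = d (d + 1)`.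
[cite: FergusonBaileyArno1999, Lemma 9 (proof)] -/
theorem two_mul_pslqPiExp (d : ℕ) : 2 * pslqPiExp d = d * (d + 1) := by
  induction d with
  | zero => simp [pslqPiExp]
  | succ d ih =>
    have hs : pslqPiExp (d + 1) = pslqPiExp d + d + 1 := by
      unfold pslqPiExp
      rw [Fin.sum_univ_castSucc]
      simp only [Fin.val_castSucc, Fin.val_last, Nat.add_sub_cancel_left]
      have : ∑ j : Fin d, (d + 1 - (j : ℕ)) = ∑ j : Fin d, ((d - (j : ℕ)) + 1) := by
        apply Finset.sum_congr rfl
        intro j _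
        have := j.isLt
        omega
      rw [this, Finset.sum_add_distrib, Finset.sum_const, Finset.card_univ, Fintype.card_fin,
        smul_eq_mul, mul_one]
    rw [hs]
    nlinarith [ih]

/-- `∑_{j<d} (d − j) = (d+1 choose 2) = (n choose 2)`. [cite: FergusonBaileyArno1999, Lemma 9 (proof)] -/
theorem pslqPiExp_eq_choose (d : ℕ) : pslqPiExp d = (d + 1).choose 2 := by
  have h2 := two_mul_pslqPiExp d
  rw [Nat.choose_two_right, Nat.add_sub_cancel]
  have : (d + 1) * d = pslqPiExp d * 2 := by rw [mul_comm (pslqPiExp d), h2]; ring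
  rw [this, Nat.mul_div_cancel _ two_pos]

/-- **Lemma 9 (i).** "`(γ^{n−1} M_x)^{(n choose 2)} ≥ Π(k) ≥ 1`" — for diagonal sizes in `(0, 1]`
(Lemma 6) and `G = γ^{n−1} M_x ≥ 1` ("`M_x ≥ 1` and `1/|h_{j,j}(k)| ≥ 1` by Lemma 6. This gives
`min{M_x, 1/|h_{j,j}(k)|} ≥ 1` … it is always the case that `M_x ≥ min{M_x, 1/|h_{j,j}(k)|}`, which
together with the fact that `(n choose 2) = n − 1 + ⋯ + 2 + 1` … gives the left hand inequality").
[cite: FergusonBaileyArno1999, Lemma 9 (i)] -/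
theorem FergusonBaileyArno1999_lemma9_i {G : ℝ} (hG : 1 ≤ G) {h : Fin d → ℝ} (h0 : ∀ j, 0 < h j)
    (h1 : ∀ j, h j ≤ 1) : 1 ≤ pslqPi G h ∧ pslqPi G h ≤ G ^ pslqPiExp d := by
  have hb1 : ∀ j, 1 ≤ min G (1 / h j) := fun j => le_min hG (one_le_one_div (h0 j) (h1 j))
  have hb0 : ∀ j, 0 ≤ min G (1 / h j) := fun j => zero_le_one.trans (hb1 j)
  unfold pslqPi pslqPiExp
  constructor
  · calc (1 : ℝ) = ∏ j : Fin d, (1 : ℝ) := (Finset.prod_const_one).symm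
      _ ≤ ∏ j : Fin d, (min G (1 / h j)) ^ (d - (j : ℕ)) := by
          apply Finset.prod_le_prod (fun j _ => zero_le_one)
          intro j _
          exact one_le_pow₀ (hb1 j)
  · rw [← Finset.prod_pow_eq_pow_sum]
    apply Finset.prod_le_prod (fun j _ => pow_nonneg (hb0 j) _)
    intro j _
    exact pow_le_pow_left₀ (hb0 j) (min_le_left _ _) _

namespace PSLQDiagStep

variable {γ : ℝ} {h h' : Fin d → ℝ} {r : Fin d} {β : ℝ}

/-- **Lemma 9 (ii).** "`Π(k) ≥ τ Π(k − 1)`" — across one iteration of PSLQ(γ), with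
`G = γ^{n−1} M_x`, provided Theorem 1 holds for the old diagonal (`∃ j₀, 1 ≤ |h_{j₀,j₀}| M_x`,
feeding Lemma 8) and the new diagonal is still zero-free ("For the `k`'s so far, `h_{j,j}(k) ≠ 0`").
Case `r < n − 1`: `FergusonBaileyArno1999_lemma9_corner_factors`; case `r = n − 1`:
`FergusonBaileyArno1999_lemma9_last_factor`. [cite: FergusonBaileyArno1999, Lemma 9 (ii)] -/
theorem tau_mul_pslqPi_le (S : PSLQDiagStep γ h h' r β) (hγ : 2 / Real.sqrt 3 < γ) {M : ℝ}
    (hT1 : ∃ j₀, 1 ≤ h j₀ * M) (hpos' : ∀ j, 0 < h' j) :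
    pslqTau γ * pslqPi (γ ^ d * M) h ≤ pslqPi (γ ^ d * M) h' := by
  have h3 : 0 < Real.sqrt 3 := Real.sqrt_pos.mpr (by norm_num)
  have h32 : Real.sqrt 3 < 2 := (Real.sqrt_lt' two_pos).mpr (by norm_num)
  have hγ1 : 1 < γ := lt_trans ((one_lt_div h3).mpr h32) hγ
  have hγ0 : 0 < γ := lt_trans one_pos hγ1
  have hτ1 : 1 < pslqTau γ := one_lt_pslqTau hγ
  have hτ0 : 0 < pslqTau γ := pslqTau_pos γ
  have hτγ : pslqTau γ ≤ γ := pslqTau_le_self hγ0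
  have hα : 0 < h r := S.pos r
  set G := γ ^ d * M with hG_def
  -- Lemma 8: `G α ≥ γ`
  have hd : d - 1 + 1 = d := Nat.sub_add_cancel (Fin.pos r)
  have hGα : γ ≤ G * h r := by
    have l8 := S.lemma8 hγ1.le hT1
    calc γ = γ * 1 := (mul_one γ).symm
      _ ≤ γ * (γ ^ (d - 1) * M * h r) := mul_le_mul_of_nonneg_left l8 hγ0.le
      _ = G * h r := by
          rw [hG_def]
          conv_rhs => rw [← hd, pow_succ]
          ring
  have hG0 : 0 < G := pos_of_mul_pos_left (lt_of_lt_of_le hγ0 hGα) hα.le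
  -- the factors of `Π`
  set F : Fin d → ℝ := fun j => (min G (1 / h j)) ^ (d - (j : ℕ)) with hF_def
  set F' : Fin d → ℝ := fun j => (min G (1 / h' j)) ^ (d - (j : ℕ)) with hF'_def
  have hF'0 : ∀ j, 0 ≤ F' j := fun j => pow_nonneg (le_min hG0.le (le_of_lt (one_div_pos.mpr (hpos' j)))) _
  change pslqTau γ * ∏ j, F j ≤ ∏ j, F' j
  rw [← Finset.mul_prod_erase _ _ (Finset.mem_univ r), ← Finset.mul_prod_erase _ _ (Finset.mem_univ r)]
  rcases Nat.lt_or_ge ((r : ℕ) + 1) d with hr | hr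
  · -- case `r < n − 1`: two factors change
    set r1 : Fin d := ⟨(r : ℕ) + 1, hr⟩ with hr1_def
    have hr1 : r1 ∈ Finset.univ.erase r := by
      rw [Finset.mem_erase]; exact ⟨fun e => by have := congrArg Fin.val e; simp [hr1_def] at this, Finset.mem_univ _⟩
    rw [← Finset.mul_prod_erase _ _ hr1, ← Finset.mul_prod_erase _ _ hr1]
    have hrest : ∏ j ∈ (Finset.univ.erase r).erase r1, F' j = ∏ j ∈ (Finset.univ.erase r).erase r1, F j := by
      apply Finset.prod_congr rfl
      intro j hj
      rw [Finset.mem_erase, Finset.mem_erase] at hj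
      have hj1 : (j : ℕ) ≠ (r : ℕ) + 1 := fun e => hj.1 (Fin.ext (by rw [e, hr1_def]))
      simp only [hF_def, hF'_def, S.unchanged j hj.2.1 hj1]
    rw [hrest]
    have hP : 0 ≤ ∏ j ∈ (Finset.univ.erase r).erase r1, F j := by
      rw [← hrest]; exact Finset.prod_nonneg fun j _ => hF'0 j
    obtain ⟨hδ0, hlδ, hδ⟩ := S.delta_bounds hγ0 hr
    have key : pslqTau γ * (F r * F r1) ≤ F' r * F' r1 := by
      simp only [hF_def, hF'_def]
      rw [S.corner_fst hr, S.corner_snd hr, one_div_div]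
      have he : d - (r : ℕ) = (d - ((r : ℕ) + 1)) + 1 := by omega
      rw [show (d - (r1 : ℕ)) = d - ((r : ℕ) + 1) from rfl, he]
      exact FergusonBaileyArno1999_lemma9_corner_factors hα (S.pos r1) hlδ hδ hτ1 hτγ hGα
        (Nat.succ_le_succ (Nat.zero_le _))
    calc pslqTau γ * (F r * (F r1 * ∏ j ∈ (Finset.univ.erase r).erase r1, F j))
        = pslqTau γ * (F r * F r1) * ∏ j ∈ (Finset.univ.erase r).erase r1, F j := by ring
      _ ≤ (F' r * F' r1) * ∏ j ∈ (Finset.univ.erase r).erase r1, F j :=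
          mul_le_mul_of_nonneg_right key hP
      _ = F' r * (F' r1 * ∏ j ∈ (Finset.univ.erase r).erase r1, F j) := by ring
  · -- case `r = n − 1`: only the last factor changes
    have hr' : (r : ℕ) + 1 = d := le_antisymm r.isLt hr
    have hrest : ∏ j ∈ Finset.univ.erase r, F' j = ∏ j ∈ Finset.univ.erase r, F j := by
      apply Finset.prod_congr rfl
      intro j hj
      rw [Finset.mem_erase] at hj
      have hj1 : (j : ℕ) ≠ (r : ℕ) + 1 := by have := j.isLt; omega
      simp only [hF_def, hF'_def, S.unchanged j hj.1 hj1]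
    rw [hrest]
    have hP : 0 ≤ ∏ j ∈ Finset.univ.erase r, F j := by
      rw [← hrest]; exact Finset.prod_nonneg fun j _ => hF'0 j
    have hβ0 : 0 < |β| := by rw [← S.last hr']; exact hpos' r
    have key : pslqTau γ * F r ≤ F' r := by
      simp only [hF_def, hF'_def]
      rw [S.last hr', show d - (r : ℕ) = 1 by omega, pow_one, pow_one]
      exact FergusonBaileyArno1999_lemma9_last_factor hα hβ0 S.reduced hγ1 (pslqTau_le_two γ) hτγ hGα
    calc pslqTau γ * (F r * ∏ j ∈ Finset.univ.erase r, F j)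
        = pslqTau γ * F r * ∏ j ∈ Finset.univ.erase r, F j := by ring
      _ ≤ F' r * ∏ j ∈ Finset.univ.erase r, F j := mul_le_mul_of_nonneg_right key hP

end PSLQDiagStep

/-- **Theorem 2 (iteration bound), real case, on the diagonal.** "Assume real or complex numbers,
`n ≥ 2`, `τ > 1`, and that `0 ≠ x ∈ K^n` has `O(K)` integer relations. Let `M_x` be the least norm of
relations for `x`. Then PSLQ(τ) will find some integer relation for `x` in no more than
`(n choose 2) · log(γ^{n−1} M_x) / log τ` iterations." Proof as printed: "Suppose we have done `k`
iterations; then … `|h_{j,j}(k)| ≠ 0` and not all `|h_{j,j}(l)| < 1/M_x` for `l < k`. By Lemma 6,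
`Π(0) ≥ 1`, and by Lemma 9, `Π(k) ≥ τ^k`, so that `(γ^{n−1} M_x)^{(n choose 2)} ≥ τ^k`. Taking
natural logarithms … `(n choose 2) log(γ^{n−1} M_x) ≥ k log τ`."

Formalised over a run `hs 0, hs 1, …, hs K` of diagonal-size vectors (`d = n − 1`) linked by
`PSLQDiagStep`s, all zero-free, starting below `1` (`H(0) = H_x`, `pslqH_diag_le_one`), with
Theorem 1's conclusion `∃ j₀, 1 ≤ |h_{j₀,j₀}(k)| M_x` available before every step
(`FergusonBaileyArno1999_theorem1_pslqH` transported along `H(k) = A H_x Q`) and `M_x ≥ 1` (the norm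
of a non-zero integer vector): then `τ^K ≤ (γ^{n−1} M_x)^{(n choose 2)}` and
`K ≤ (n choose 2) log(γ^{n−1} M_x)/log τ`. [cite: FergusonBaileyArno1999, Theorem 2] -/
theorem FergusonBaileyArno1999_theorem2 {γ M : ℝ} (hγ : 2 / Real.sqrt 3 < γ) (hM : 1 ≤ M)
    {hs : ℕ → Fin d → ℝ} {r : ℕ → Fin d} {β : ℕ → ℝ} {K : ℕ}
    (hstep : ∀ k < K, PSLQDiagStep γ (hs k) (hs (k + 1)) (r k) (β k))
    (hpos : ∀ k ≤ K, ∀ j, 0 < hs k j) (h0 : ∀ j, hs 0 j ≤ 1)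
    (hT1 : ∀ k < K, ∃ j₀, 1 ≤ hs k j₀ * M) :
    pslqTau γ ^ K ≤ (γ ^ d * M) ^ (d + 1).choose 2 ∧
      (K : ℝ) ≤ ((d + 1).choose 2 : ℝ) * Real.log (γ ^ d * M) / Real.log (pslqTau γ) := by
  have h3 : 0 < Real.sqrt 3 := Real.sqrt_pos.mpr (by norm_num)
  have h32 : Real.sqrt 3 < 2 := (Real.sqrt_lt' two_pos).mpr (by norm_num)
  have hγ1 : 1 < γ := lt_trans ((one_lt_div h3).mpr h32) hγ
  have hτ1 : 1 < pslqTau γ := one_lt_pslqTau hγ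
  have hτ0 : 0 < pslqTau γ := pslqTau_pos γ
  have hG1 : 1 ≤ γ ^ d * M := one_le_mul_of_one_le_of_one_le (one_le_pow₀ hγ1.le) hM
  -- Lemma 6 along the run
  have hle1 : ∀ k ≤ K, ∀ j, hs k j ≤ 1 := by
    intro k
    induction k with
    | zero => intro _; exact h0
    | succ k ih =>
      intro hk
      exact (hstep k (Nat.lt_of_succ_le hk)).le_one hγ (ih (Nat.le_of_succ_le hk))
  -- Lemma 9 (ii) along the run: `τ^k ≤ Π(k)`
  have hPi : ∀ k ≤ K, pslqTau γ ^ k ≤ pslqPi (γ ^ d * M) (hs k) := by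
    intro k
    induction k with
    | zero =>
      intro _
      rw [pow_zero]
      exact (FergusonBaileyArno1999_lemma9_i hG1 (hpos 0 (Nat.zero_le _)) h0).1
    | succ k ih =>
      intro hk
      have hk' : k < K := Nat.lt_of_succ_le hk
      calc pslqTau γ ^ (k + 1) = pslqTau γ * pslqTau γ ^ k := by rw [pow_succ]; ring
        _ ≤ pslqTau γ * pslqPi (γ ^ d * M) (hs k) :=
            mul_le_mul_of_nonneg_left (ih hk'.le) hτ0.le
        _ ≤ pslqPi (γ ^ d * M) (hs (k + 1)) :=
            (hstep k hk').tau_mul_pslqPi_le hγ (hT1 k hk') (hpos (k + 1) hk)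
  have hpow : pslqTau γ ^ K ≤ (γ ^ d * M) ^ (d + 1).choose 2 := by
    rw [← pslqPiExp_eq_choose]
    exact (hPi K le_rfl).trans
      (FergusonBaileyArno1999_lemma9_i hG1 (hpos K le_rfl) (hle1 K le_rfl)).2
  refine ⟨hpow, ?_⟩
  -- "Taking natural logarithms of both sides"
  have hlogτ : 0 < Real.log (pslqTau γ) := Real.log_pos hτ1
  have hlog := Real.log_le_log (pow_pos hτ0 K) hpow
  rw [Real.log_pow, Real.log_pow] at hlog
  rw [le_div_iff₀ hlogτ]
  exact hlog

/-- `τ = √2` for `γ = 2` in the real case (`1/τ² = 1/4 + 1/4`). [cite: FergusonBaileyArno1999, Corollary 2 (proof)] -/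
theorem pslqTau_two : pslqTau 2 = Real.sqrt 2 := by
  unfold pslqTau
  rw [show (1 : ℝ) / 4 + 1 / 2 ^ 2 = 1 / 2 by norm_num, Real.sqrt_div' _ (by norm_num : (0:ℝ) ≤ 2),
    Real.sqrt_one, one_div_one_div]

/-- **Corollary 2, real case** (`K = ℝ`, `dim_ℝ K = 1`, `γ = 2`): "PSLQ(τ) will construct some `O(K)^n`
relation for `x` in no more than `2 · (dim_ℝ K) · (n³ + n² log M_x)` iterations. Proof. Let `γ = 2`.
Then … `τ > 1`; specifically, `1/log τ < 4 dim_ℝ K`." Here `n = d + 1` and the bound of Theorem 2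
with `γ = 2`, `τ = √2` is at most `2 (n³ + n² log M_x)`. [cite: FergusonBaileyArno1999, Corollary 2] -/
theorem FergusonBaileyArno1999_corollary2_real {M : ℝ} (hM : 1 ≤ M)
    {hs : ℕ → Fin d → ℝ} {r : ℕ → Fin d} {β : ℕ → ℝ} {K : ℕ}
    (hstep : ∀ k < K, PSLQDiagStep 2 (hs k) (hs (k + 1)) (r k) (β k))
    (hpos : ∀ k ≤ K, ∀ j, 0 < hs k j) (h0 : ∀ j, hs 0 j ≤ 1)
    (hT1 : ∀ k < K, ∃ j₀, 1 ≤ hs k j₀ * M) :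
    (K : ℝ) ≤ 2 * (((d : ℝ) + 1) ^ 3 + ((d : ℝ) + 1) ^ 2 * Real.log M) := by
  have h3 : 0 < Real.sqrt 3 := Real.sqrt_pos.mpr (by norm_num)
  have hγ : 2 / Real.sqrt 3 < (2 : ℝ) := by
    rw [div_lt_iff₀ h3]
    have : 1 < Real.sqrt 3 := (Real.lt_sqrt zero_le_one).mpr (by norm_num)
    nlinarith
  have hT := (FergusonBaileyArno1999_theorem2 hγ hM hstep hpos h0 hT1).2
  have hlog2 : (0.6931471803 : ℝ) < Real.log 2 := Real.log_two_gt_d9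
  have hlogτ : Real.log (pslqTau 2) = Real.log 2 / 2 := by
    rw [pslqTau_two, Real.log_sqrt (by norm_num : (0:ℝ) ≤ 2)]
  have hM0 : 0 < M := lt_of_lt_of_le one_pos hM
  have hlogM : 0 ≤ Real.log M := Real.log_nonneg hM
  have hlogG : Real.log ((2 : ℝ) ^ d * M) = d * Real.log 2 + Real.log M := by
    rw [Real.log_mul (pow_ne_zero _ two_ne_zero) hM0.ne', Real.log_pow]
  have hC : (((d + 1).choose 2 : ℕ) : ℝ) * 2 = (d : ℝ) * ((d : ℝ) + 1) := by
    have h := two_mul_pslqPiExp d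
    rw [pslqPiExp_eq_choose] at h
    have h' : (((2 * (d + 1).choose 2 : ℕ)) : ℝ) = ((d * (d + 1) : ℕ) : ℝ) := by rw [h]
    push_cast at h'
    linarith
  rw [hlogτ, hlogG] at hT
  -- `K ≤ C (d log 2 + log M) / (log 2 / 2) = d(d+1) (d + log M / log 2)`
  have hlog2pos : 0 < Real.log 2 := by linarith
  have e : (((d + 1).choose 2 : ℕ) : ℝ) * ((d : ℝ) * Real.log 2 + Real.log M) / (Real.log 2 / 2)
      = (d : ℝ) * ((d : ℝ) + 1) * (d : ℝ) + (d : ℝ) * ((d : ℝ) + 1) * (Real.log M / Real.log 2) := by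
    field_simp
    linear_combination ((d : ℝ) * Real.log 2 + Real.log M) * hC
  have hT' : (K : ℝ) ≤ (d : ℝ) * ((d : ℝ) + 1) * (d : ℝ) +
      (d : ℝ) * ((d : ℝ) + 1) * (Real.log M / Real.log 2) := by
    have : (K : ℝ) ≤ (((d + 1).choose 2 : ℕ) : ℝ) * ((d : ℝ) * Real.log 2 + Real.log M) /
        (Real.log 2 / 2) := by exact_mod_cast hT
    rw [e] at this; exact this
  have hd0 : (0 : ℝ) ≤ d := Nat.cast_nonneg d
  have hq : Real.log M / Real.log 2 ≤ 2 * Real.log M := by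
    rw [div_le_iff₀ hlog2pos]; nlinarith
  calc (K : ℝ) ≤ (d : ℝ) * ((d : ℝ) + 1) * (d : ℝ) + (d : ℝ) * ((d : ℝ) + 1) * (Real.log M / Real.log 2) := hT'
    _ ≤ ((d : ℝ) + 1) ^ 3 + ((d : ℝ) + 1) * ((d : ℝ) + 1) * (2 * Real.log M) := by
        apply add_le_add
        · nlinarith
        · apply mul_le_mul _ hq (div_nonneg hlogM hlog2pos.le) (by positivity)
          nlinarith
    _ ≤ 2 * (((d : ℝ) + 1) ^ 3 + ((d : ℝ) + 1) ^ 2 * Real.log M) := by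
        nlinarith [pow_nonneg (by linarith : (0:ℝ) ≤ (d : ℝ) + 1) 3]

/-! ## Lemma 5, second half: a zero diagonal entry hands over a relation -/

/-- **Lemma 5 (relation extraction).** "By induction, the last, `(n−1)`-th, column of
`H(k − 1) = A H_x Q_{k−1}` has exactly one non-zero unit, say in row `i` … `0 = x B(k−1) H(k−1)` and
the `i`-th entry of `xB` is zero. This means that the `i`-th column of `B` is a relation for `x`."
Abstractly: if `x H_x = 0`, `B A = I` over `ℤ`, and column `c` of `A H_x Q` is supported in the single
row `i` with a non-zero entry there, then `(x B)_i = 0`, i.e. `∑_l x_l B_{l,i} = 0` — column `i` of the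
integer matrix `B` is an integer relation for `x` (it is non-zero by
`FergusonBaileyArno1999_lemma5_column_ne_zero`). This is the termination branch "`h_{n−1,n−1}(k) = 0`"
of Step 4. [cite: FergusonBaileyArno1999, Lemma 5] -/
theorem FergusonBaileyArno1999_lemma5_relation {n m : ℕ} (x : Fin n → ℝ)
    (Hx : Matrix (Fin n) (Fin m) ℝ) (hx : Matrix.vecMul x Hx = 0) (A B : Matrix (Fin n) (Fin n) ℤ)
    (hBA : B * A = 1) (Q : Matrix (Fin m) (Fin m) ℝ) (i : Fin n) (c : Fin m)
    (hcol : ∀ l, l ≠ i → (A.map (Int.cast : ℤ → ℝ) * Hx * Q) l c = 0)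
    (hic : (A.map (Int.cast : ℤ → ℝ) * Hx * Q) i c ≠ 0) :
    Matrix.vecMul x (B.map (Int.cast : ℤ → ℝ)) i = 0 := by
  set A' : Matrix (Fin n) (Fin n) ℝ := A.map (Int.cast : ℤ → ℝ) with hA'
  set B' : Matrix (Fin n) (Fin n) ℝ := B.map (Int.cast : ℤ → ℝ) with hB'
  have hBA' : B' * A' = 1 := by
    have := congrArg (Int.castRingHom ℝ).mapMatrix hBA
    rw [map_mul, map_one] at this
    simpa [RingHom.mapMatrix_apply] using this
  set y : Fin n → ℝ := Matrix.vecMul x B' with hy_def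
  have hy : Matrix.vecMul y (A' * Hx * Q) = 0 := by
    rw [hy_def, Matrix.vecMul_vecMul, ← Matrix.mul_assoc, ← Matrix.mul_assoc, hBA', Matrix.one_mul,
      ← Matrix.vecMul_vecMul, hx, Matrix.zero_vecMul]
  have hyc := congrFun hy c
  simp only [Matrix.vecMul, dotProduct, Pi.zero_apply] at hyc
  rw [Finset.sum_eq_single i (fun l _ hl => by rw [hcol l hl, mul_zero])
    (fun hi => absurd (Finset.mem_univ i) hi)] at hyc
  exact (mul_eq_zero.mp hyc).resolve_right hic

/-- With `B A = I` over `ℤ` every column of `B` is non-zero — "`B = A^{−1} ∈ GL(n, O(K))`" in the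
proof of Lemma 5 — so the relation of `FergusonBaileyArno1999_lemma5_relation` is a genuine (non-zero)
integer relation. [cite: FergusonBaileyArno1999, Lemma 5 (proof)] -/
theorem FergusonBaileyArno1999_lemma5_column_ne_zero {n : ℕ} (A B : Matrix (Fin n) (Fin n) ℤ)
    (hBA : B * A = 1) (i : Fin n) : (fun l => B l i) ≠ 0 := by
  intro h
  have hdet : B.det * A.det = 1 := by rw [← Matrix.det_mul, hBA, Matrix.det_one]
  have hB0 : B.det = 0 := Matrix.det_eq_zero_of_column_eq_zero i (fun l => congrFun h l)
  rw [hB0, zero_mul] at hdet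
  exact zero_ne_one hdet

end Literature.NumberTheory.DiophantineApproximation
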